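import Literature.IUT.HodgeTheaters.PuncturedEllipticCoveringsModLCuspLaws
import HarnessLib

/-!
# [IUTchI] Cor. 1.2 — the law `hIH` ("every cusp inertia group of `X̲` lies in `H = Ker(Δ_X ↠ Δ_X^{ab} ⊗ ℤ/l)`")
# and (L1) of `ModLCuspLaws` from the commutator description of the cusp inertia — proof-only bridge

Mochizuki, *Inter-universal Teichmüller theory I*, kurims manuscript (May 2020), §1, pp. 37–39
([IUTchI] §1 pp.37–39) [claim: Mochizuki2012, status: disputed]; the classical input is [AbsTopI] Lemma 4.5 (i)
p. 54 (`Δ` of a once-punctured curve of genus one is free profinite on two generators `a, b`, the cusp inertia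
being the closed procyclic subgroup on their commutator, up to conjugacy) and [AbsTopIII] Prop. 1.4 (i) p. 31
(cusp inertia `≅ Ẑ(1)`).  Node `IUTchI:Cor1.2`; cell abc-iut, seat abc-iut-f-090 (gen 8), row
«COR12-INERTIA-COMMUTATOR» = §R R2 of abc-iut-L5-t1's census `SUBDAG-IUTchI-Cor12.md` (2026-08-27).  PROOF-ONLY
companion (no definitions, no instances, no notation, nothing restated) over abc-iut-L5-t1's FROZEN
`PuncturedEllipticCoverings.lean` (p404449) and `…ModLCuspLaws.lean` (p446054).

WHAT THIS FILE DOES.  The Layer-5 closer of record for [IUTchI] Cor. 1.2 at the genuine `K`-level datum,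
`Summit.ABC.IUTFork.Conditional.layer5_held_cor12_v6` (over abc-iut-L5-d4's
`InitialThetaData.pe_characteristicNatureOfCoverings_viaX_of_laws`, p448270), binds among its 14 laws the
classical-shaped law

  `hIH' : ∀ x : D'.geom.pe.Cusp, D'.geom.pe.inertia x ≤ H'`,
  `H' := (⁅Δ'_X, Δ'_X⁆ ⊔ closure {y ^ l' | y ∈ Δ'_X})⁻`, `Δ'_X := Π'_X ∩ Δ'_C`

("the cusps of `X̲'` lie over THE cusp of `X'`, whose inertia dies in `Δ_X^{ab} ⊗ ℤ/l`", p. 39 l. 29–33), and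
abc-iut-L5-t1's record `ModLCuspLaws` binds (L1) "each cusp inertia group is procyclic" (p. 37 l. 32).  Both are
FORMAL consequences of the ONE classical origin datum isolated by the census (its items (A) + (c)):

  (c)  for some `a, b ∈ Δ_X`, every cusp inertia group `I_x` (`x` a cusp of `X̲`) is the closed procyclic
       subgroup topologically generated by a `Δ_X`-conjugate of the commutator `[a, b] = a b a⁻¹ b⁻¹`
       — equivalently (`conj_smul_topologicalClosure_zpowers`) a `Δ_X`-conjugate `g • ⟨[a, b]⟩⁻` of the
       closed procyclic subgroup on `[a, b]` ([AbsTopI] Lem. 4.5 (i) at `X_K = E_K ∖ {O}`, where `a, b` are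
       free generators of `Δ_X ≅ F̂₂`; freeness itself — item (A) — is NOT needed for these two laws),

namely: `g [a, b] g⁻¹ = [g a g⁻¹, g b g⁻¹] ∈ ⁅Δ_X, Δ_X⁆ ⊆ H`, `H` is closed, so `⟨g [a, b] g⁻¹⟩⁻ ⊆ H`
(`inertia_le_H_of_commutatorCusp`, `…_smul`, `…_gens`); and `⟨z⟩⁻` with `z := g [a, b] g⁻¹ ∈ I_x` is the
procyclic presentation (L1) asks for (`inertia_procyclic_of_commutatorCusp`).  The `gens : Fin 2 → Δ_X` forms
compose with the census's item (A) `IsFreeProOn ↥Δ_X Set.univ gens` as displayed by row R1 (abc-iut-L5-t1).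
Private folklore lemmas (any topological group): `topologicalClosure_zpowers_le_of_mem`,
`conj_commutator_mem_commutator`, `conj_commutator_mem_modL`, `topologicalClosure_zpowers_conj_commutator_le`,
`mem_conj_smul_iff`, `isClosed_conj_smul`, `conj_smul_topologicalClosure_zpowers` (`g • ⟨c⟩⁻ = ⟨g c g⁻¹⟩⁻`).

HONEST FRAMING: classical (pro)finite group theory applied to hypothesis binders quoting print; (c) is an
assumption label (an origin datum of the étale fundamental group of `X_K`), never asserted; a law derived from
a displayed origin binder is not a token flip; nothing here asserts that abc is proved or refuted or takes a
side on [IUTchIII] Cor. 3.12; typed ≠ inhabited ≠ discharged; no printed statement is strengthened.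
-/

namespace Literature.IUT.HodgeTheaters

namespace PuncturedEllipticData

open scoped Pointwise

universe u

/-! ### Group theory: closed procyclic subgroups on conjugates of commutators -/

section Algebra

variable {P : Type*} [Group P]

/-- A conjugate `g [a, b] g⁻¹ = [g a g⁻¹, g b g⁻¹]` of a commutator of elements of `Δ` by an element of `Δ` is
a commutator of elements of `Δ`, hence lies in the commutator subgroup `[Δ, Δ]`. [folklore] -/
private theorem conj_commutator_mem_commutator {Δ : Subgroup P} {a b g : P} (ha : a ∈ Δ) (hb : b ∈ Δ)
    (hg : g ∈ Δ) : g * (a * b * a⁻¹ * b⁻¹) * g⁻¹ ∈ ⁅Δ, Δ⁆ := by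
  have e : g * (a * b * a⁻¹ * b⁻¹) * g⁻¹ =
      g * a * g⁻¹ * (g * b * g⁻¹) * (g * a * g⁻¹)⁻¹ * (g * b * g⁻¹)⁻¹ := by group
  rw [e]
  -- `⁅g₁, g₂⁆ ∈ ⁅H₁, H₂⁆` (the element bracket unfolds to `g₁ * g₂ * g₁⁻¹ * g₂⁻¹`)
  exact Subgroup.commutator_mem_commutator (Δ.mul_mem (Δ.mul_mem hg ha) (Δ.inv_mem hg))
    (Δ.mul_mem (Δ.mul_mem hg hb) (Δ.inv_mem hg))

/-- Membership in the conjugate subgroup `g • K = g K g⁻¹` (`MulAut.conj g • K`): `x ∈ g K g⁻¹ ↔ g⁻¹ x g ∈ K`.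
[folklore] -/
private theorem mem_conj_smul_iff (g : P) (K : Subgroup P) (x : P) :
    x ∈ MulAut.conj g • K ↔ g⁻¹ * x * g ∈ K := by
  rw [Subgroup.mem_pointwise_smul_iff_inv_smul_mem, MulAut.smul_def, MulAut.conj_inv_apply]

end Algebra

section Topology

variable {P : Type*} [Group P] [TopologicalSpace P] [IsTopologicalGroup P]

/-- `⟨c⟩⁻ ≤ K⁻` as soon as `c ∈ K⁻` (`K⁻` is a closed subgroup containing `⟨c⟩`). [folklore] -/
private theorem topologicalClosure_zpowers_le_of_mem {c : P} {K : Subgroup P}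
    (hc : c ∈ K.topologicalClosure) :
    (Subgroup.zpowers c).topologicalClosure ≤ K.topologicalClosure :=
  Subgroup.topologicalClosure_minimal _ ((Subgroup.zpowers_le).mpr hc)
    (Subgroup.isClosed_topologicalClosure K)

/-- For `a, b, g ∈ Δ`, the conjugate commutator `g [a, b] g⁻¹` lies in the closed subgroup
`(⁅Δ, Δ⁆ ⊔ closure {y ^ l | y ∈ Δ})⁻` (= `Ker(Δ ↠ Δ^{ab} ⊗ ℤ/l)` when `Δ` is profinite). [folklore] -/
private theorem conj_commutator_mem_modL {Δ : Subgroup P} (l : ℕ) {a b g : P} (ha : a ∈ Δ) (hb : b ∈ Δ)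
    (hg : g ∈ Δ) :
    g * (a * b * a⁻¹ * b⁻¹) * g⁻¹ ∈
      (⁅Δ, Δ⁆ ⊔ Subgroup.closure ((fun y : P => y ^ l) '' (Δ : Set P))).topologicalClosure :=
  Subgroup.le_topologicalClosure _ (Subgroup.mem_sup_left (conj_commutator_mem_commutator ha hb hg))

/-- For `a, b, g ∈ Δ`, the closed procyclic subgroup `⟨g [a, b] g⁻¹⟩⁻` lies in
`(⁅Δ, Δ⁆ ⊔ closure {y ^ l | y ∈ Δ})⁻`. [folklore] -/
private theorem topologicalClosure_zpowers_conj_commutator_le {Δ : Subgroup P} (l : ℕ) {a b g : P}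
    (ha : a ∈ Δ) (hb : b ∈ Δ) (hg : g ∈ Δ) :
    (Subgroup.zpowers (g * (a * b * a⁻¹ * b⁻¹) * g⁻¹)).topologicalClosure ≤
      (⁅Δ, Δ⁆ ⊔ Subgroup.closure ((fun y : P => y ^ l) '' (Δ : Set P))).topologicalClosure :=
  topologicalClosure_zpowers_le_of_mem (conj_commutator_mem_modL l ha hb hg)

/-- The conjugate `g • K` of a closed subgroup `K` is closed (it is the preimage of `K` under the continuous
map `x ↦ g⁻¹ x g`). [folklore] -/
private theorem isClosed_conj_smul (g : P) {K : Subgroup P} (hK : IsClosed (K : Set P)) :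
    IsClosed ((MulAut.conj g • K : Subgroup P) : Set P) := by
  have e : ((MulAut.conj g • K : Subgroup P) : Set P) = (fun x : P => g⁻¹ * x * g) ⁻¹' (K : Set P) := by
    ext x
    exact mem_conj_smul_iff g K x
  rw [e]
  exact hK.preimage ((continuous_const.mul continuous_id).mul continuous_const)

/-- **`g • ⟨c⟩⁻ = ⟨g c g⁻¹⟩⁻`**: the conjugate of the closed procyclic subgroup topologically generated by `c`
is the closed procyclic subgroup topologically generated by the conjugate `g c g⁻¹`. [folklore] -/
private theorem conj_smul_topologicalClosure_zpowers (g c : P) :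
    MulAut.conj g • (Subgroup.zpowers c).topologicalClosure =
      (Subgroup.zpowers (g * c * g⁻¹)).topologicalClosure := by
  apply le_antisymm
  · -- `g • ⟨c⟩⁻ ≤ ⟨g c g⁻¹⟩⁻`, from `⟨c⟩⁻ ≤ g⁻¹ • ⟨g c g⁻¹⟩⁻`
    have h : (Subgroup.zpowers c).topologicalClosure ≤
        MulAut.conj g⁻¹ • (Subgroup.zpowers (g * c * g⁻¹)).topologicalClosure := by
      refine Subgroup.topologicalClosure_minimal _ ?_
        (isClosed_conj_smul g⁻¹ (Subgroup.isClosed_topologicalClosure _))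
      rw [Subgroup.zpowers_le, mem_conj_smul_iff, inv_inv]
      exact Subgroup.le_topologicalClosure _ (Subgroup.mem_zpowers _)
    intro x hx
    rw [mem_conj_smul_iff] at hx
    have hx' := h hx
    rw [mem_conj_smul_iff, inv_inv] at hx'
    have e : g * (g⁻¹ * x * g) * g⁻¹ = x := by group
    rwa [e] at hx'
  · refine Subgroup.topologicalClosure_minimal _ ?_
      (isClosed_conj_smul g (Subgroup.isClosed_topologicalClosure _))
    rw [Subgroup.zpowers_le, mem_conj_smul_iff]
    have e : g⁻¹ * (g * c * g⁻¹) * g = c := by group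
    rw [e]
    exact Subgroup.le_topologicalClosure _ (Subgroup.mem_zpowers _)

end Topology

/-! ### [IUTchI] §1 / Cor. 1.2: the laws `hIH` and (L1) at a datum of type `(1, l-tors)` -/

variable (D : PuncturedEllipticData.{u})

/-- **Law `hIH` of `layer5_held_cor12_v6` from the commutator description of the cusp inertia** (element
form).  If, for some `a, b ∈ Δ_X = Π_X ∩ Δ_C`, every cusp inertia group `I_x` of `X̲` is the closed procyclic
subgroup topologically generated by a `Δ_X`-conjugate `g [a, b] g⁻¹` of the commutator `[a, b]` — the cusp of
the once-punctured elliptic curve `X`, [AbsTopI] Lem. 4.5 (i) — then every `I_x` lies in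
`H = (⁅Δ_X, Δ_X⁆ ⊔ closure {y ^ l | y ∈ Δ_X})⁻ = Ker(Δ_X ↠ Δ_X^{ab} ⊗ ℤ/l)` ("we conclude that
`Π_X̲ = Π_{X̲→} · H`", p. 39 l. 29–33: the cusps of `X̲` lie over the cusp of `X`). ([IUTchI] §1 p.39)
[claim: Mochizuki2012, status: disputed] -/
theorem inertia_le_H_of_commutatorCusp {a b : D.PiC} (ha : a ∈ D.PiX ⊓ D.DeltaC)
    (hb : b ∈ D.PiX ⊓ D.DeltaC)
    (hcusp : ∀ x : D.Cusp, ∃ g ∈ D.PiX ⊓ D.DeltaC,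
      D.inertia x = (Subgroup.zpowers (g * (a * b * a⁻¹ * b⁻¹) * g⁻¹)).topologicalClosure) :
    ∀ x : D.Cusp, D.inertia x ≤ (⁅D.PiX ⊓ D.DeltaC, D.PiX ⊓ D.DeltaC⁆ ⊔ Subgroup.closure
      ((fun y : D.PiC => y ^ D.l) '' (D.PiX ⊓ D.DeltaC : Set D.PiC))).topologicalClosure := by
  intro x
  obtain ⟨g, hg, hx⟩ := hcusp x
  rw [hx]
  exact topologicalClosure_zpowers_conj_commutator_le D.l ha hb hg

/-- **Law `hIH` from the commutator description of the cusp inertia** (conjugate-subgroup form): the same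
conclusion when each `I_x` is displayed as a `Δ_X`-conjugate `g • ⟨[a, b]⟩⁻` (`MulAut.conj g`) of the closed
procyclic subgroup on `[a, b]`, via `g • ⟨[a, b]⟩⁻ = ⟨g [a, b] g⁻¹⟩⁻`. ([IUTchI] §1 p.39)
[claim: Mochizuki2012, status: disputed] -/
theorem inertia_le_H_of_commutatorCusp_smul {a b : D.PiC} (ha : a ∈ D.PiX ⊓ D.DeltaC)
    (hb : b ∈ D.PiX ⊓ D.DeltaC)
    (hcusp : ∀ x : D.Cusp, ∃ g ∈ D.PiX ⊓ D.DeltaC,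
      D.inertia x = MulAut.conj g • (Subgroup.zpowers (a * b * a⁻¹ * b⁻¹)).topologicalClosure) :
    ∀ x : D.Cusp, D.inertia x ≤ (⁅D.PiX ⊓ D.DeltaC, D.PiX ⊓ D.DeltaC⁆ ⊔ Subgroup.closure
      ((fun y : D.PiC => y ^ D.l) '' (D.PiX ⊓ D.DeltaC : Set D.PiC))).topologicalClosure := by
  refine D.inertia_le_H_of_commutatorCusp ha hb fun x => ?_
  obtain ⟨g, hg, hx⟩ := hcusp x
  exact ⟨g, hg, hx.trans (conj_smul_topologicalClosure_zpowers g _)⟩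

/-- **Law `hIH` in the `gens : Fin 2 → Δ_X` shape of the census's item (A)** (`IsFreeProOn ↥Δ_X Set.univ gens`,
row R1 of abc-iut-L5-t1): with `a = gens 0`, `b = gens 1`, every cusp inertia group `⟨g [a, b] g⁻¹⟩⁻`
(`g ∈ Δ_X`) lies in `H`.  Freeness of `Δ_X` on `gens` is not used. ([IUTchI] §1 p.39)
[claim: Mochizuki2012, status: disputed] -/
theorem inertia_le_H_of_commutatorCusp_gens (gens : Fin 2 → ↥(D.PiX ⊓ D.DeltaC))
    (hcusp : ∀ x : D.Cusp, ∃ g ∈ D.PiX ⊓ D.DeltaC,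
      D.inertia x = (Subgroup.zpowers (g * ((gens 0 : D.PiC) * (gens 1 : D.PiC) *
        (gens 0 : D.PiC)⁻¹ * (gens 1 : D.PiC)⁻¹) * g⁻¹)).topologicalClosure) :
    ∀ x : D.Cusp, D.inertia x ≤ (⁅D.PiX ⊓ D.DeltaC, D.PiX ⊓ D.DeltaC⁆ ⊔ Subgroup.closure
      ((fun y : D.PiC => y ^ D.l) '' (D.PiX ⊓ D.DeltaC : Set D.PiC))).topologicalClosure :=
  D.inertia_le_H_of_commutatorCusp (gens 0).2 (gens 1).2 hcusp

/-- **(L1) of abc-iut-L5-t1's `ModLCuspLaws` from the commutator description of the cusp inertia**: if every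
cusp inertia group `I_x` of `X̲` is the closed procyclic subgroup `⟨g [a, b] g⁻¹⟩⁻` on a conjugate of the
commutator, then "the inertia groups of … cusps" (p. 37 l. 32) are procyclic in the recorded sense — `I_x ≤ ⟨z⟩⁻`
for some `z ∈ I_x`, namely `z = g [a, b] g⁻¹` (cusp inertia `≅ Ẑ(1)`, [AbsTopIII] Prop. 1.4 (i)).
([IUTchI] §1 p.37) [claim: Mochizuki2012, status: disputed] -/
theorem inertia_procyclic_of_commutatorCusp {a b : D.PiC}
    (hcusp : ∀ x : D.Cusp, ∃ g ∈ D.PiX ⊓ D.DeltaC,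
      D.inertia x = (Subgroup.zpowers (g * (a * b * a⁻¹ * b⁻¹) * g⁻¹)).topologicalClosure) :
    ∀ x : D.Cusp, ∃ z ∈ D.inertia x, D.inertia x ≤ (Subgroup.zpowers z).topologicalClosure := by
  intro x
  obtain ⟨g, -, hx⟩ := hcusp x
  exact ⟨g * (a * b * a⁻¹ * b⁻¹) * g⁻¹, hx ▸ Subgroup.le_topologicalClosure _ (Subgroup.mem_zpowers _),
    hx.le⟩

/-- **(L1) of `ModLCuspLaws`, conjugate-subgroup form** (`I_x = g • ⟨[a, b]⟩⁻`). ([IUTchI] §1 p.37)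
[claim: Mochizuki2012, status: disputed] -/
theorem inertia_procyclic_of_commutatorCusp_smul {a b : D.PiC}
    (hcusp : ∀ x : D.Cusp, ∃ g ∈ D.PiX ⊓ D.DeltaC,
      D.inertia x = MulAut.conj g • (Subgroup.zpowers (a * b * a⁻¹ * b⁻¹)).topologicalClosure) :
    ∀ x : D.Cusp, ∃ z ∈ D.inertia x, D.inertia x ≤ (Subgroup.zpowers z).topologicalClosure := by
  refine D.inertia_procyclic_of_commutatorCusp (a := a) (b := b) fun x => ?_
  obtain ⟨g, hg, hx⟩ := hcusp x
  exact ⟨g, hg, hx.trans (conj_smul_topologicalClosure_zpowers g _)⟩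

end PuncturedEllipticData

end Literature.IUT.HodgeTheaters
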